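import Summits.Ventures.CertifiedQuantumChemistry.Certificates.HubbardRingL4SingletDualBlockDud
import Summits.Ventures.CertifiedQuantumChemistry.Certificates.HubbardRingL4SingletDualBlockQud
import Summits.Ventures.CertifiedQuantumChemistry.Certificates.HubbardRingL4SingletDualBlockG0B
import Summits.Ventures.CertifiedQuantumChemistry.Certificates.HubbardRingL4SingletDualBlockGud
import Summits.Ventures.CertifiedQuantumChemistry.Certificates.HubbardRingL4SingletDualBlockGdu
import Summits.Ventures.CertifiedQuantumChemistry.Certificates.HubbardRingL4SingletDualMult
import Summits.Ventures.CertifiedQuantumChemistry.Rows.BlockScatterPSD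
import HarnessLib

/-!
# Ventures/CertifiedQuantumChemistry — Certificates/HubbardRingL4SingletDualFamily.lean: the per-order `Dual` records of the explicit
# finite-`U` dual certificate family for the `(2,2)`-sector `DQG + ⟨Ŝ²⟩ = 0` programme of the Hubbard 4-ring, and the positivity of
# the `ε`-combined dual tables for every real `ε`

HONEST FRAMING (verbatim): certified bounds for a stated model Hamiltonian in a stated basis; not a claim about the real molecule beyond that model. An AUXILIARY dual object; no model value, no row, no claim node.

Seat rdm-B (gen 44). `dualAt m` (`m < 5`, coefficient of `ε^m`, `ε = 1/U`; everything `× 1024`): the dual tables are the scatters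
(`BlockScatter.scatter`) of the block tables `tDud m`, `tQud m` (mixed-spin pair codes `(p↑,q↓) ↦ 4p+q`) and `tG0 m` (like-spin
particle–hole codes `(pσ,qσ) ↦ 16σ+4p+q`) `+ tGud m + tGdu m` (`(p↑,q↓)`, `(p↓,q↑) ↦ 4p+q`); the multipliers and the target are the
order-`m` slices of `…SingletDualMult.lean`. **`posSemidef_zD/zQ/zG`**: for every rational `ε` the three real tables of
`polyDual dualAt ε` are positive semidefinite (scatters / sums of scatters of the block families `S(ε)·Pz·S(ε)ᵀ ⪰ 0` of the block
files). The per-order checks `(dualAt m).check = true` are the five companion files `…SingletDualCheck{0…4}.lean` (one kernel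
`decide` each). 0 sorry; small `def`s (`labUD`, `labDU`, `labG0`, `posUD`, `posG0`, `dualAt`); standard axioms.
-/

set_option linter.style.longLine false

namespace Summit.Ventures.CertifiedQuantumChemistry

namespace DualL4.Singlet

open Matrix Finset BlockScatter
open Literature.MathematicalPhysics.QuantumLattice

/-- Block label of the mixed-spin pair codes `(p↑, q↓)` (label `1`; everything else `0`). -/
def labUD (P : OP) : ℕ := if sp P.1 = 0 ∧ sp P.2 = 1 then 1 else 0
/-- Block label of the codes `(p↓, q↑)`. -/
def labDU (P : OP) : ℕ := if sp P.1 = 1 ∧ sp P.2 = 0 then 1 else 0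
/-- Block label of the like-spin codes `(pσ, qσ)`. -/
def labG0 (P : OP) : ℕ := if sp P.1 = sp P.2 then 1 else 0
/-- Position `4p + q` inside a `16`-block. -/
def posUD (P : OP) : ℕ := 4 * (st P.1 : ℕ) + (st P.2 : ℕ)
/-- Position `16σ + 4p + q` inside the `32`-block. -/
def posG0 (P : OP) : ℕ := 16 * (sp P.1 : ℕ) + 4 * (st P.1 : ℕ) + (st P.2 : ℕ)

/-- The order-`m` `Dual` record of the family (`m < 5`). -/
noncomputable def dualAt (m : Fin 5) : Dual where
  zD := scatter 16 labUD posUD 1 (tDud m)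
  zQ := scatter 16 labUD posUD 1 (tQud m)
  zG := fun P R => scatter 32 labG0 posG0 1 (tG0 m) P R + scatter 16 labUD posUD 1 (tGud m) P R + scatter 16 labDU posUD 1 (tGdu m) P R
  nu := fun x y τ => nuTab m (DQGGap.eOrb x) (DQGGap.eOrb y) τ
  tOne := tOneV m
  tUp := tUpV m
  tDn := tDnV m
  tUU := tUUV m
  tDD := tDDV m
  tUD := tUDV m
  xi := xiV m
  cd := cdV m
  ch := chV m
  mu := muV m

/-! ## Positivity of the `ε`-combined tables -/

/-- The real cast of an `ε`-combination of scatters is the scatter of the real block family. -/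
theorem realZ_sum_scatter {k : ℕ} (T : Fin 5 → Matrix (Fin k) (Fin k) ℚ) (lab pos : OP → ℕ) (ε : ℚ) :
    Dual.realZ (fun P R => ∑ m : Fin 5, ε ^ (m : ℕ) * scatter k lab pos 1 (T m) P R) =
      scatter k lab pos 1 (realPoly T (ε : ℝ)) := by
  ext P R
  simp only [Dual.realZ, Matrix.of_apply, scatter_apply, realPoly, Matrix.sum_apply, Matrix.smul_apply, Matrix.map_apply,
    smul_eq_mul]
  split_ifs with h
  · push_cast; rfl
  · simp

/-- **`zD(ε) ⪰ 0`** for every rational `ε`. -/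
theorem posSemidef_zD (ε : ℚ) : (Dual.realZ (polyDual dualAt ε).zD).PosSemidef := by
  have e : (polyDual dualAt ε).zD = fun P R => ∑ m : Fin 5, ε ^ (m : ℕ) * scatter 16 labUD posUD 1 (tDud m) P R := rfl
  rw [e, realZ_sum_scatter]
  exact posSemidef_scatter _ _ _ _ (posSemidef_realT_Dud _)

/-- **`zQ(ε) ⪰ 0`** for every rational `ε`. -/
theorem posSemidef_zQ (ε : ℚ) : (Dual.realZ (polyDual dualAt ε).zQ).PosSemidef := by
  have e : (polyDual dualAt ε).zQ = fun P R => ∑ m : Fin 5, ε ^ (m : ℕ) * scatter 16 labUD posUD 1 (tQud m) P R := rfl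
  rw [e, realZ_sum_scatter]
  exact posSemidef_scatter _ _ _ _ (posSemidef_realT_Qud _)

/-- **`zG(ε) ⪰ 0`** for every rational `ε` (sum of the three particle–hole block scatters). -/
theorem posSemidef_zG (ε : ℚ) : (Dual.realZ (polyDual dualAt ε).zG).PosSemidef := by
  have e : Dual.realZ (polyDual dualAt ε).zG =
      Dual.realZ (fun P R => ∑ m : Fin 5, ε ^ (m : ℕ) * scatter 32 labG0 posG0 1 (tG0 m) P R)
      + Dual.realZ (fun P R => ∑ m : Fin 5, ε ^ (m : ℕ) * scatter 16 labUD posUD 1 (tGud m) P R)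
      + Dual.realZ (fun P R => ∑ m : Fin 5, ε ^ (m : ℕ) * scatter 16 labDU posUD 1 (tGdu m) P R) := by
    ext P R
    simp only [Dual.realZ, Matrix.of_apply, Matrix.add_apply, polyDual, dualAt, mul_add, Finset.sum_add_distrib]
    push_cast
    rfl
  rw [e, realZ_sum_scatter, realZ_sum_scatter, realZ_sum_scatter]
  exact ((posSemidef_scatter _ _ _ _ (posSemidef_realT_G0 _)).add (posSemidef_scatter _ _ _ _ (posSemidef_realT_Gud _))).add
    (posSemidef_scatter _ _ _ _ (posSemidef_realT_Gdu _))

end DualL4.Singlet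

end Summit.Ventures.CertifiedQuantumChemistry
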